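import Summits.QuantumFields.YangMills.Theorems.BalabanUVNodesN19JointLawRate

/-!
# YM-DAG node N19 (= NE7 proper) — A RATE FOR THE WHOLE STRING-FIELD LAW in the product metric (uniform bounded-Lipschitz convergence)

Cell `pub-ymgap`, HUMAN RULING D-0062 (Track A), R141 (C) wider-strategy seat `pub-ymgap-dag-n19-e` (strategy s3 = ALTERNATIVE CURRENCY), generation
g19, module 6 (lineage module 58).  Route `Summits/QuantumFields/YangMills/Theses/BalabanUVNodes.lean` rev 25, cluster item K3⁷ «SpineGivenEndpointR13SepCoPH»
(stmt-QuantumFields-20544, dag-lead WORDS-143); filed `--supports` that item `--as helper` (it proves no registered stub).  COUNT-NEUTRAL: bookkeeping over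
the sibling p570436 `…N19JointLawRate` (`abs_integral_cylinder_sub_le_of_uniformTarget`, tensor Bernstein + p482030's string-independent rate) and Mathlib `tsum`
algebra; `Spine.NE7.Target` (N19's DECL-target shape, NOT PRINTED, NOT proved) and the law hypotheses are HYPOTHESES; no Theses import; NOT a discharge claim.

THE RESULT.  Fix ANY sequence of strings `e : ℕ → List O` and weigh the coordinates geometrically: the product pseudo-metric
`d_e(x, y) = Σ_j 2^{−(j+1)}|x_{e_j} − y_{e_j}|` on the cube `[−1,1]^{List O}` (for an enumeration `e` it metrises the product topology).  Under N19's
DECL-target shape for EVERY string with common data (`∀ os, Spine.NE7.Target vol l₀ δ (schemeZ S os)`, `0 < l₀`), if a probability law `Λ` on `ℝ^{List O}`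
carried by the cube receives the limits of all continuous functionals of the string field (p564785's string-field law), then for every continuous `F` with
`|F x − F y| ≤ K·d_e(x, y)` and `|F| ≤ G` on the cube, every truncation level `m`, every Bernstein degree `n ≥ 1` and every step `K`:
  ★★ `abs_integral_stringField_sub_le_of_uniformTarget`:
  `|∫ F((∏os)_{os}) dgibbs_K − ∫ F dΛ| ≤ 2K·2^{−m} + 2K·m∕√n + G·2^{n·m}·R_K`, `R_K = (4e^{1+l₀}∕l₀)·τ_K·(1 + log⁺ τ_K⁻¹)`, `τ_K = Σ_m 2·vol·δ_{K+m}`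
(truncate `F` to the first `m` weighted coordinates — error `K·2^{−m}` under each law; the truncation is a cylinder functional of `≤ m` strings,
`K`-Lipschitz in `ℓ¹` — the sibling's joint rate).  Hence ★ `stringFieldLaw_boundedLipschitz_of_uniformTarget`: for every `η > 0` ONE `K₀` with
`|∫ F dlaw_K − ∫ F dΛ| ≤ η` for all `K ≥ K₀` and ALL `F` in the `d_e`-bounded-Lipschitz unit ball — a quantitative (Fortet–Mourier-type) form of the weak
convergence of the law of the whole string field.  NOT claimed sharp.

HONEST FRAMING (binding).  [folklore] ∕ bookkeeping; `Λ` is a typed RESTATEMENT DEVICE for the string-indexed limits (dag-lead guard); NO consumer in the DAG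
today; `Target` HYPOTHESIS; nothing of Bałaban's instantiated; NE7 NOT PRINTED, NOT proved; N19 NOT discharged; count-neutral.  One finite `T⁴` programme at
fixed `ε` → 0 at FIXED volume; NOT a continuum ∕ `ℝ⁴` ∕ infinite-volume ∕ OS ∕ mass-gap ∕ Clay statement.  0 `def` ∕ 0 `sorry`.
-/

noncomputable section

open Real Finset Filter Topology MeasureTheory ProbabilityTheory

namespace Summit.QuantumFields.YangMills.Theorems.BalabanUVNodesN19StringFieldLawRate

open Literature.MathematicalPhysics.QuantumFieldTheory.Balaban1983to89
open T4GenFunBounds (prodObs gibbsMeasure schemeZ)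
open Missing (TorusScheme)
open Summit.QuantumFields.BalabanUV.T4Continuum.Spine
open Summit.QuantumFields.YangMills.BalabanUVNodes.N19ExpectationCurrencyAtScheme (mul_nonneg_of_matchingModConstants)
open Summit.QuantumFields.YangMills.BalabanUVNodes.N19ExpectationCurrencyTwoConstantsRate (tendsto_linlog_of_tendsto_zero)
open Summit.QuantumFields.YangMills.Theorems.BalabanUVNodesN19JointLawRate (abs_integral_cylinder_sub_le_of_uniformTarget)

/-! ## §1 The weighted product pseudo-metric and truncation to finitely many coordinates [folklore] -/

section Metric

variable {O : Type*} [DecidableEq O]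

/-- The weights `2^{−(j+1)}` sum to `1`. [bookkeeping] -/
theorem tsum_half_pow_succ : ∑' j : ℕ, (1 / 2 : ℝ) ^ (j + 1) = 1 := by
  have h : ∑' j : ℕ, (1 / 2 : ℝ) ^ (j + 1) = ∑' j : ℕ, (1 / 2 : ℝ) * (1 / 2) ^ j := tsum_congr fun j => by ring
  rw [h, summable_geometric_two.tsum_mul_left, tsum_geometric_two]
  norm_num

/-- On the cube the weighted coordinate distances are summable (dominated by the weights). [bookkeeping] -/
theorem summable_weighted_of_le {a : ℕ → ℝ} (h0 : ∀ j, 0 ≤ a j) {C : ℝ} (hC : ∀ j, a j ≤ C) :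
    Summable fun j => (1 / 2 : ℝ) ^ (j + 1) * a j := by
  refine Summable.of_nonneg_of_le (fun j => mul_nonneg (by positivity) (h0 j)) (fun j => mul_le_mul_of_nonneg_left (hC j) (by positivity))
    ((summable_geometric_two.mul_left (1 / 2 : ℝ)).mul_right C |>.congr fun j => by ring)

/-- Tail bound: if the first `m` terms vanish and all terms are `≤ 1`, then `Σ_j 2^{−(j+1)} a_j ≤ 2^{−m}`. [bookkeeping] -/
theorem tsum_weighted_le_of_vanish {a : ℕ → ℝ} (h0 : ∀ j, 0 ≤ a j) (h1 : ∀ j, a j ≤ 1) {m : ℕ} (hm : ∀ j, j < m → a j = 0) :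
    ∑' j, (1 / 2 : ℝ) ^ (j + 1) * a j ≤ (1 / 2 : ℝ) ^ m := by
  have hs := summable_weighted_of_le h0 h1
  rw [← hs.sum_add_tsum_nat_add m, Finset.sum_eq_zero fun j hj => by rw [hm j (Finset.mem_range.1 hj), mul_zero], zero_add]
  have hid : (fun j : ℕ => (1 / 2 : ℝ) ^ (j + m + 1) * a (j + m)) = fun j => (1 / 2 : ℝ) ^ m * ((1 / 2 : ℝ) ^ (j + 1) * a (j + m)) := by
    funext j
    rw [show j + m + 1 = m + (j + 1) by ring, pow_add, mul_assoc]
  have hsm : Summable fun j : ℕ => (1 / 2 : ℝ) ^ (j + 1) * a (j + m) := summable_weighted_of_le (fun j => h0 _) fun j => h1 _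
  have hs1 : Summable fun j : ℕ => (1 / 2 : ℝ) ^ (j + 1) := by simpa using summable_weighted_of_le (a := fun _ => (1 : ℝ)) (fun _ => zero_le_one) fun _ => le_rfl
  rw [hid, tsum_mul_left]
  refine mul_le_of_le_one_right (by positivity) ?_
  calc ∑' j : ℕ, (1 / 2 : ℝ) ^ (j + 1) * a (j + m) ≤ ∑' j : ℕ, (1 / 2 : ℝ) ^ (j + 1) :=
        hsm.tsum_le_tsum (fun j => mul_le_of_le_one_right (by positivity) (h1 _)) hs1
    _ = 1 := tsum_half_pow_succ

/-- **TRUNCATION TO THE FIRST `m` WEIGHTED COORDINATES** [folklore]: for `F` with `|F x − F y| ≤ K·Σ_j 2^{−(j+1)}|x_{e_j} − y_{e_j}|` on the cube and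
`x` in the cube, replacing every coordinate outside `{e_0, …, e_{m−1}}` by `0` moves `F` by at most `K·2^{−m}`. -/
theorem abs_sub_truncate_le (e : ℕ → List O) {F : (List O → ℝ) → ℝ} {K : ℝ} (hK0 : 0 ≤ K)
    (hF : ∀ x y : List O → ℝ, (∀ os, x os ∈ Set.Icc (-1 : ℝ) 1) → (∀ os, y os ∈ Set.Icc (-1 : ℝ) 1) →
      |F x - F y| ≤ K * ∑' j, (1 / 2 : ℝ) ^ (j + 1) * |x (e j) - y (e j)|)
    (m : ℕ) (x : List O → ℝ) (hx : ∀ os, x os ∈ Set.Icc (-1 : ℝ) 1) :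
    |F x - F (fun os => if os ∈ (Finset.range m).image e then x os else 0)| ≤ K * (1 / 2 : ℝ) ^ m := by
  classical
  have hy : ∀ os, (if os ∈ (Finset.range m).image e then x os else 0) ∈ Set.Icc (-1 : ℝ) 1 := fun os => by
    split_ifs
    · exact hx os
    · norm_num
  refine (hF x _ hx hy).trans (mul_le_mul_of_nonneg_left (tsum_weighted_le_of_vanish (fun j => abs_nonneg _) (fun j => ?_) fun j hj => ?_) hK0)
  · split_ifs
    · simp
    · rw [sub_zero]; exact abs_le.2 ⟨(hx _).1, (hx _).2⟩
  · rw [if_pos (Finset.mem_image.2 ⟨j, Finset.mem_range.2 hj, rfl⟩), sub_self, abs_zero]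

/-- **A CYLINDER FUNCTIONAL CUT OUT OF `F` IS `K`-LIPSCHITZ (ℓ¹)** [folklore]: for ANY finite set `J` of strings and `u, v ∈ [−1,1]^J`,
`|F(ext u) − F(ext v)| ≤ K·Σ_{os∈J}|u_{os} − v_{os}|` (`ext` = extension by `0`; each weighted term is one of the `J`-coordinates or vanishes, and the
weights sum to `1`). -/
theorem abs_sub_cylinder_le (e : ℕ → List O) {F : (List O → ℝ) → ℝ} {K : ℝ} (hK0 : 0 ≤ K)
    (hF : ∀ x y : List O → ℝ, (∀ os, x os ∈ Set.Icc (-1 : ℝ) 1) → (∀ os, y os ∈ Set.Icc (-1 : ℝ) 1) →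
      |F x - F y| ≤ K * ∑' j, (1 / 2 : ℝ) ^ (j + 1) * |x (e j) - y (e j)|)
    (J : Finset (List O)) (u v : ↥J → ℝ) (hu : ∀ i, u i ∈ Set.Icc (-1 : ℝ) 1) (hv : ∀ i, v i ∈ Set.Icc (-1 : ℝ) 1) :
    |F (fun os => if h : os ∈ J then u ⟨os, h⟩ else 0) - F (fun os => if h : os ∈ J then v ⟨os, h⟩ else 0)| ≤ K * ∑ i, |u i - v i| := by
  have hxu : ∀ os, (if h : os ∈ J then u ⟨os, h⟩ else 0) ∈ Set.Icc (-1 : ℝ) 1 := fun os => by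
    by_cases h : os ∈ J
    · rw [dif_pos h]; exact hu _
    · rw [dif_neg h]; norm_num
  have hxv : ∀ os, (if h : os ∈ J then v ⟨os, h⟩ else 0) ∈ Set.Icc (-1 : ℝ) 1 := fun os => by
    by_cases h : os ∈ J
    · rw [dif_pos h]; exact hv _
    · rw [dif_neg h]; norm_num
  refine (hF _ _ hxu hxv).trans (mul_le_mul_of_nonneg_left ?_ hK0)
  have hS0 : 0 ≤ ∑ i, |u i - v i| := Finset.sum_nonneg fun i _ => abs_nonneg _
  have hterm : ∀ j, |(if h : e j ∈ J then u ⟨e j, h⟩ else 0) - (if h : e j ∈ J then v ⟨e j, h⟩ else 0)| ≤ ∑ i, |u i - v i| := fun j => by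
    by_cases h : e j ∈ J
    · rw [dif_pos h, dif_pos h]
      exact Finset.single_le_sum (f := fun i : ↥J => |u i - v i|) (fun i _ => abs_nonneg _) (Finset.mem_univ (⟨e j, h⟩ : ↥J))
    · rw [dif_neg h, dif_neg h, sub_zero, abs_zero]; exact hS0
  have hs := summable_weighted_of_le (fun j => abs_nonneg _) hterm
  have hs1 : Summable fun j : ℕ => (1 / 2 : ℝ) ^ (j + 1) * ∑ i, |u i - v i| :=
    summable_weighted_of_le (a := fun _ => ∑ i, |u i - v i|) (fun _ => hS0) fun _ => le_rfl
  calc ∑' j, (1 / 2 : ℝ) ^ (j + 1) * |(if h : e j ∈ J then u ⟨e j, h⟩ else 0) - (if h : e j ∈ J then v ⟨e j, h⟩ else 0)|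
      ≤ ∑' j, (1 / 2 : ℝ) ^ (j + 1) * ∑ i, |u i - v i| := hs.tsum_le_tsum (fun j => mul_le_mul_of_nonneg_left (hterm j) (by positivity)) hs1
    _ = ∑ i, |u i - v i| := by rw [tsum_mul_right, tsum_half_pow_succ, one_mul]

end Metric

/-! ## §2 At the scheme under uniform `Target`: the rate for the whole string-field law -/

section Scheme

variable {G : Type*} [GaugeGroup G] [MeasurableSpace G] [RegularGaugeGroup G] [HaarData G] {O : Type*}
  (S : TorusScheme G O) (hβ : ∀ K, 0 ≤ S.β K) (hm : ∀ K o, Measurable (S.obs K o))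
  (h1 : ∀ K o U, |S.obs K o U| ≤ 1)

include hβ hm h1

/-- **★★ A RATE FOR THE WHOLE STRING-FIELD LAW IN THE PRODUCT METRIC** [folklore + bookkeeping].  Torus scheme with `β_K ≥ 0`, measurable `|obs| ≤ 1`,
countably many labels; uniform `Target` (`∀ os, Spine.NE7.Target vol l₀ δ (schemeZ S os)`, `0 < l₀` — HYPOTHESIS); `Λ` a probability law on `ℝ^{List O}`
carried by the cube receiving the limits of all continuous functionals of the string field; `e : ℕ → List O` any sequence of strings; `F` continuous with
`|F x − F y| ≤ K_F·Σ_j 2^{−(j+1)}|x_{e_j} − y_{e_j}|` and `|F| ≤ G_F` on the cube.  Then for every `m`, every `n ≥ 1` and every step `K`: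
`|∫ F((∏os)_{os}) dgibbs_K − ∫ F dΛ| ≤ 2K_F·2^{−m} + 2K_F·m∕√n + G_F·2^{n·m}·(4e^{1+l₀}∕l₀)·τ_K·(1 + log⁺ τ_K⁻¹)`. -/
theorem abs_integral_stringField_sub_le_of_uniformTarget [Countable O] {vol l₀ : ℝ} {δ : ℕ → ℝ} (hl₀ : 0 < l₀)
    (hT : ∀ os : List O, NE7.Target vol l₀ δ (schemeZ S os)) (Λ : Measure (List O → ℝ)) [IsProbabilityMeasure Λ]
    (hΛ1 : Λ (Set.pi Set.univ (fun _ : List O => Set.Icc (-1 : ℝ) 1))ᶜ = 0)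
    (hΛ : ∀ F : (List O → ℝ) → ℝ, Continuous F →
      Tendsto (fun K => ∫ U, F (fun os => prodObs S K os U) ∂gibbsMeasure (S.P K) (S.β K)) atTop (𝓝 (∫ x, F x ∂Λ)))
    (e : ℕ → List O) {F : (List O → ℝ) → ℝ} (hFc : Continuous F) {KF GF : ℝ} (hK0 : 0 ≤ KF)
    (hF : ∀ x y : List O → ℝ, (∀ os, x os ∈ Set.Icc (-1 : ℝ) 1) → (∀ os, y os ∈ Set.Icc (-1 : ℝ) 1) →
      |F x - F y| ≤ KF * ∑' j, (1 / 2 : ℝ) ^ (j + 1) * |x (e j) - y (e j)|)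
    (hG : ∀ x : List O → ℝ, (∀ os, x os ∈ Set.Icc (-1 : ℝ) 1) → |F x| ≤ GF) (m : ℕ) {n : ℕ} (hn : n ≠ 0) (K : ℕ) :
    |∫ U, F (fun os => prodObs S K os U) ∂gibbsMeasure (S.P K) (S.β K) - ∫ x, F x ∂Λ| ≤
      2 * KF * (1 / 2 : ℝ) ^ m + 2 * KF * (m / Real.sqrt n) + GF * 2 ^ (n * m) *
        (4 * Real.exp (1 + l₀) / l₀ * (∑' j, 2 * (vol * δ (K + j))) * (1 + Real.posLog (∑' j, 2 * (vol * δ (K + j)))⁻¹)) := by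
  classical
  haveI hP : IsProbabilityMeasure (gibbsMeasure (G := G) (S.P K) (S.β K)) := T4GenFunBounds.isProbabilityMeasure_gibbsMeasure (G := G) (S.P K) (hβ K)
  set J : Finset (List O) := (Finset.range m).image e with hJ
  -- the truncation and the cylinder functional
  set T : (List O → ℝ) → (List O → ℝ) := fun x os => if os ∈ J then x os else 0 with hTdef
  set f : (↥J → ℝ) → ℝ := fun u => F (fun os => if h : os ∈ J then u ⟨os, h⟩ else 0) with hfdef
  have hTf : ∀ x : List O → ℝ, F (T x) = f (fun i : ↥J => x i.1) := fun x => by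
    simp only [hfdef, hTdef, dite_eq_ite]
  have hext : Continuous fun u : ↥J → ℝ => fun os : List O => if h : os ∈ J then u ⟨os, h⟩ else (0 : ℝ) :=
    continuous_pi fun os => by
      by_cases h : os ∈ J
      · simp only [dif_pos h]; exact continuous_apply _
      · simp only [dif_neg h]; exact continuous_const
  have hfc : Continuous f := hFc.comp hext
  have hTc : Continuous T := continuous_pi fun os => by
    by_cases h : os ∈ J
    · simp only [hTdef, if_pos h]; exact continuous_apply os
    · simp only [hTdef, if_neg h]; exact continuous_const
  -- the cylinder functional is `K`-Lipschitz (ℓ¹) and `G`-bounded on the cube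
  have hfK : ∀ u v : ↥J → ℝ, (∀ i, u i ∈ Set.Icc (-1 : ℝ) 1) → (∀ i, v i ∈ Set.Icc (-1 : ℝ) 1) → |f u - f v| ≤ KF * ∑ i, |u i - v i| :=
    fun u v hu hv => abs_sub_cylinder_le e hK0 hF J u v hu hv
  have hfG : ∀ u : ↥J → ℝ, (∀ i, u i ∈ Set.Icc (-1 : ℝ) 1) → |f u| ≤ GF := fun u hu => hG _ fun os => by
    by_cases h : os ∈ J
    · simp only [dif_pos h]; exact hu _
    · simp only [dif_neg h]; norm_num
  -- the sibling's joint rate on the cylinder functional (`|J| ≤ m`)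
  have hcyl := abs_integral_cylinder_sub_le_of_uniformTarget S hβ hm h1 hl₀ hT (fun i : ↥J => i.1) Λ hΛ1 hΛ hfc hK0 hfK hfG hn K
  have hcard : (Fintype.card ↥J : ℝ) ≤ m := by
    rw [Fintype.card_coe]
    exact_mod_cast (Finset.card_image_le.trans (Finset.card_range m).le)
  have hR0 : 0 ≤ 4 * Real.exp (1 + l₀) / l₀ * (∑' j, 2 * (vol * δ (K + j))) * (1 + Real.posLog (∑' j, 2 * (vol * δ (K + j)))⁻¹) :=
    mul_nonneg (mul_nonneg (div_nonneg (mul_nonneg (by norm_num) (Real.exp_pos _).le) hl₀.le)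
      (tsum_nonneg fun j => mul_nonneg two_pos.le (mul_nonneg_of_matchingModConstants hl₀.le (hT []).1 (K + j))))
      (add_nonneg zero_le_one Real.posLog_nonneg)
  have hGF0 : 0 ≤ GF := (abs_nonneg _).trans (hG (fun _ => 0) fun _ => by norm_num)
  have hcyl' : |∫ U, f (fun i : ↥J => prodObs S K i.1 U) ∂gibbsMeasure (S.P K) (S.β K) - ∫ x, f (fun i : ↥J => x i.1) ∂Λ| ≤
      2 * KF * (m / Real.sqrt n) + GF * 2 ^ (n * m) *
        (4 * Real.exp (1 + l₀) / l₀ * (∑' j, 2 * (vol * δ (K + j))) * (1 + Real.posLog (∑' j, 2 * (vol * δ (K + j)))⁻¹)) := by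
    refine hcyl.trans (add_le_add ?_ ?_)
    · exact mul_le_mul_of_nonneg_left (div_le_div_of_nonneg_right hcard (Real.sqrt_nonneg _)) (by positivity)
    · refine mul_le_mul_of_nonneg_right (mul_le_mul_of_nonneg_left ?_ hGF0) hR0
      exact pow_le_pow_right₀ (by norm_num) (Nat.mul_le_mul_left n
        (by rw [Fintype.card_coe]; exact Finset.card_image_le.trans (Finset.card_range m).le))
  -- truncation errors under both laws
  have hX1 : ∀ U : GaugeField (S.P K) 0 G, ∀ os, prodObs S K os U ∈ Set.Icc (-1 : ℝ) 1 := fun U os =>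
    abs_le.1 (T4GenFunBounds.abs_prodObs_le_one S h1 K os U)
  have hmeasX : AEMeasurable (fun U : GaugeField (S.P K) 0 G => fun os => prodObs S K os U) (gibbsMeasure (S.P K) (S.β K)) :=
    (measurable_pi_lambda _ fun os => T4GenFunBounds.measurable_prodObs S hm K os).aemeasurable
  have hbdd : ∀ {Φ : (List O → ℝ) → ℝ}, Continuous Φ → ∃ C, ∀ x : List O → ℝ, (∀ os, x os ∈ Set.Icc (-1 : ℝ) 1) → |Φ x| ≤ C := by
    intro Φ hΦ
    obtain ⟨C, hC⟩ := (isCompact_univ_pi fun _ : List O => (isCompact_Icc : IsCompact (Set.Icc (-1 : ℝ) 1))).exists_bound_of_continuousOn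
      hΦ.continuousOn
    exact ⟨C, fun x hx => by simpa [Real.norm_eq_abs] using hC x (Set.mem_univ_pi.2 hx)⟩
  have hintX : ∀ {Φ : (List O → ℝ) → ℝ}, Continuous Φ → Integrable (fun U => Φ (fun os => prodObs S K os U)) (gibbsMeasure (S.P K) (S.β K)) := by
    intro Φ hΦ
    obtain ⟨C, hC⟩ := hbdd hΦ
    exact (integrable_const C).mono' (hΦ.comp_aestronglyMeasurable hmeasX.aestronglyMeasurable)
      (ae_of_all _ fun U => by rw [Real.norm_eq_abs]; exact hC _ (hX1 U))
  have hΛcube : ∀ᵐ x ∂Λ, x ∈ Set.pi Set.univ (fun _ : List O => Set.Icc (-1 : ℝ) 1) := mem_ae_iff.2 hΛ1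
  have hΛae : ∀ᵐ x ∂Λ, ∀ os, x os ∈ Set.Icc (-1 : ℝ) 1 := hΛcube.mono fun x hx os => Set.mem_univ_pi.1 hx os
  have hintΛ : ∀ {Φ : (List O → ℝ) → ℝ}, Continuous Φ → Integrable Φ Λ := by
    intro Φ hΦ
    obtain ⟨C, hC⟩ := hbdd hΦ
    exact (integrable_const C).mono' hΦ.aestronglyMeasurable (hΛae.mono fun x hx => by rw [Real.norm_eq_abs]; exact hC x hx)
  have herrX : |∫ U, F (fun os => prodObs S K os U) ∂gibbsMeasure (S.P K) (S.β K) -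
      ∫ U, F (T (fun os => prodObs S K os U)) ∂gibbsMeasure (S.P K) (S.β K)| ≤ KF * (1 / 2 : ℝ) ^ m := by
    rw [← integral_sub (hintX hFc) (hintX (Φ := fun x => F (T x)) (hFc.comp hTc)), ← Real.norm_eq_abs]
    refine (norm_integral_le_of_norm_le_const (Filter.Eventually.of_forall fun U => ?_)).trans (by rw [probReal_univ, mul_one])
    rw [Real.norm_eq_abs]
    exact abs_sub_truncate_le e hK0 hF m _ (hX1 U)
  have herrΛ : |∫ x, F x ∂Λ - ∫ x, F (T x) ∂Λ| ≤ KF * (1 / 2 : ℝ) ^ m := by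
    rw [← integral_sub (hintΛ hFc) (hintΛ (Φ := fun x => F (T x)) (hFc.comp hTc)), ← Real.norm_eq_abs]
    refine (norm_integral_le_of_norm_le_const (hΛae.mono fun x hx => ?_)).trans (by rw [probReal_univ, mul_one])
    rw [Real.norm_eq_abs]
    exact abs_sub_truncate_le e hK0 hF m x hx
  -- assemble
  have hmid : |∫ U, F (T (fun os => prodObs S K os U)) ∂gibbsMeasure (S.P K) (S.β K) - ∫ x, F (T x) ∂Λ| ≤
      2 * KF * (m / Real.sqrt n) + GF * 2 ^ (n * m) *
        (4 * Real.exp (1 + l₀) / l₀ * (∑' j, 2 * (vol * δ (K + j))) * (1 + Real.posLog (∑' j, 2 * (vol * δ (K + j)))⁻¹)) := by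
    simpa only [hTf] using hcyl'
  rw [abs_sub_comm] at herrΛ
  calc |∫ U, F (fun os => prodObs S K os U) ∂gibbsMeasure (S.P K) (S.β K) - ∫ x, F x ∂Λ|
      = |(∫ U, F (fun os => prodObs S K os U) ∂gibbsMeasure (S.P K) (S.β K) - ∫ U, F (T (fun os => prodObs S K os U)) ∂gibbsMeasure (S.P K) (S.β K))
          + (∫ U, F (T (fun os => prodObs S K os U)) ∂gibbsMeasure (S.P K) (S.β K) - ∫ x, F (T x) ∂Λ)
          + (∫ x, F (T x) ∂Λ - ∫ x, F x ∂Λ)| := by ring_nf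
    _ ≤ KF * (1 / 2 : ℝ) ^ m + (2 * KF * (m / Real.sqrt n) + GF * 2 ^ (n * m) *
          (4 * Real.exp (1 + l₀) / l₀ * (∑' j, 2 * (vol * δ (K + j))) * (1 + Real.posLog (∑' j, 2 * (vol * δ (K + j)))⁻¹)))
          + KF * (1 / 2 : ℝ) ^ m := (abs_add_three _ _ _).trans (add_le_add (add_le_add herrX hmid) herrΛ)
    _ = _ := by ring

/-- **★ UNIFORM BOUNDED-LIPSCHITZ CONVERGENCE OF THE WHOLE STRING-FIELD LAW** (Fortet–Mourier type) [bookkeeping]: under the same hypotheses, for every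
`η > 0` there is ONE `K₀` such that for all `K ≥ K₀` and ALL continuous `F` with `|F x − F y| ≤ d_e(x,y)` and `|F| ≤ 1` on the cube:
`|∫ F((∏os)_{os}) dgibbs_K − ∫ F dΛ| ≤ η` (choose `m` with `2·2^{−m} ≤ η∕3`, then `n` with `2m∕√n ≤ η∕3`, then `K₀` with `2^{nm}·R_K ≤ η∕3`). -/
theorem stringFieldLaw_boundedLipschitz_of_uniformTarget [Countable O] {vol l₀ : ℝ} {δ : ℕ → ℝ} (hl₀ : 0 < l₀)
    (hT : ∀ os : List O, NE7.Target vol l₀ δ (schemeZ S os)) (Λ : Measure (List O → ℝ)) [IsProbabilityMeasure Λ]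
    (hΛ1 : Λ (Set.pi Set.univ (fun _ : List O => Set.Icc (-1 : ℝ) 1))ᶜ = 0)
    (hΛ : ∀ F : (List O → ℝ) → ℝ, Continuous F →
      Tendsto (fun K => ∫ U, F (fun os => prodObs S K os U) ∂gibbsMeasure (S.P K) (S.β K)) atTop (𝓝 (∫ x, F x ∂Λ)))
    (e : ℕ → List O) {η : ℝ} (hη : 0 < η) :
    ∃ K₀ : ℕ, ∀ K, K₀ ≤ K → ∀ F : (List O → ℝ) → ℝ, Continuous F →
      (∀ x y : List O → ℝ, (∀ os, x os ∈ Set.Icc (-1 : ℝ) 1) → (∀ os, y os ∈ Set.Icc (-1 : ℝ) 1) →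
        |F x - F y| ≤ ∑' j, (1 / 2 : ℝ) ^ (j + 1) * |x (e j) - y (e j)|) →
      (∀ x : List O → ℝ, (∀ os, x os ∈ Set.Icc (-1 : ℝ) 1) → |F x| ≤ 1) →
        |∫ U, F (fun os => prodObs S K os U) ∂gibbsMeasure (S.P K) (S.β K) - ∫ x, F x ∂Λ| ≤ η := by
  -- the rate `R_K → 0`
  set τ : ℕ → ℝ := fun K => ∑' j, 2 * (vol * δ (K + j)) with hτ
  have hτ0 : ∀ K, 0 ≤ τ K := fun K =>
    tsum_nonneg fun j => mul_nonneg two_pos.le (mul_nonneg_of_matchingModConstants hl₀.le (hT []).1 (K + j))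
  have hτlim : Tendsto τ atTop (𝓝 0) := by
    have h := tendsto_sum_nat_add fun j => 2 * (vol * δ j)
    have he' : (fun i : ℕ => ∑' k : ℕ, 2 * (vol * δ (k + i))) = τ := by
      funext i
      show (∑' k : ℕ, 2 * (vol * δ (k + i))) = ∑' j, 2 * (vol * δ (i + j))
      exact tsum_congr fun k => by rw [add_comm]
    rwa [he'] at h
  -- truncation level `m`: `2·2^{−m} ≤ η∕3`
  obtain ⟨m, hmη⟩ : ∃ m : ℕ, 2 * (1 / 2 : ℝ) ^ m ≤ η / 3 := by
    obtain ⟨m, hm'⟩ := exists_pow_lt_of_lt_one (by positivity : 0 < η / 6) (by norm_num : (1 / 2 : ℝ) < 1)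
    exact ⟨m, by linarith⟩
  -- Bernstein degree `n`: `2m∕√n ≤ η∕3`
  obtain ⟨n, hn0, hn⟩ : ∃ n : ℕ, n ≠ 0 ∧ 2 * ((m : ℝ) / Real.sqrt n) ≤ η / 3 := by
    refine ⟨⌈(6 * m / η) ^ 2⌉₊ + 1, Nat.succ_ne_zero _, ?_⟩
    have hs : 6 * m / η ≤ Real.sqrt ((⌈(6 * (m : ℝ) / η) ^ 2⌉₊ + 1 : ℕ) : ℝ) := by
      refine Real.le_sqrt_of_sq_le ?_
      push_cast
      linarith [Nat.le_ceil ((6 * (m : ℝ) / η) ^ 2)]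
    have hspos : 0 < Real.sqrt ((⌈(6 * (m : ℝ) / η) ^ 2⌉₊ + 1 : ℕ) : ℝ) := Real.sqrt_pos.2 (by positivity)
    rw [mul_div_assoc', div_le_iff₀ hspos]
    calc 2 * (m : ℝ) = η / 3 * (6 * m / η) := by field_simp; ring
      _ ≤ η / 3 * Real.sqrt ((⌈(6 * (m : ℝ) / η) ^ 2⌉₊ + 1 : ℕ) : ℝ) := mul_le_mul_of_nonneg_left hs (by positivity)
  -- the step `K₀`
  have hRlim : Tendsto (fun K => (2 : ℝ) ^ (n * m) * (4 * Real.exp (1 + l₀) / l₀ * τ K * (1 + Real.posLog (τ K)⁻¹))) atTop (𝓝 0) := by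
    simpa using (tendsto_linlog_of_tendsto_zero hτ0 hτlim (4 * Real.exp (1 + l₀) / l₀)).const_mul ((2 : ℝ) ^ (n * m))
  obtain ⟨K₀, hK₀⟩ := Filter.eventually_atTop.1 (hRlim.eventually (ge_mem_nhds (by positivity : (0 : ℝ) < η / 3)))
  refine ⟨K₀, fun K hK F hFc hLip hbd => ?_⟩
  have h := abs_integral_stringField_sub_le_of_uniformTarget S hβ hm h1 hl₀ hT Λ hΛ1 hΛ e hFc zero_le_one (KF := 1) (GF := 1)
    (fun x y hx hy => by rw [one_mul]; exact hLip x y hx hy) hbd m hn0 K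
  have h2 := hK₀ K hK
  simp only [mul_one, one_mul] at h
  linarith

end Scheme

end Summit.QuantumFields.YangMills.Theorems.BalabanUVNodesN19StringFieldLawRate

end
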